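import Mathlib
import Summits.NavierStokesRegularity.NavierStokesRegularity.Theorems.FilamentSkeletonRssSelectionBoxRJRungCutoffShooting
import Summits.NavierStokesRegularity.NavierStokesRegularity.Theorems.FilamentSkeletonRssSelectionBoxRJRungModelArcZero
import Summits.NavierStokesRegularity.NavierStokesRegularity.Theorems.FilamentSkeletonRssSelectionBoxRJRungModelArcConstants

/-!
# Route `FilamentSkeletonRss` · crux `SelectionBoxRJ` (stmt-NavierStokesRegularity-21220) — RUNG 1 (MODEL RUNG):
# the cut-off local-induction arc through the rung-0 waist datum, as ONE object for all large `Γ`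

Lane `ns-filament-19175-p1` (g7), director-ns ORDER OF WORK l.3062 (B)(iii) (bc5 rung duty), rung ladder R0–R3 of
`RUNG-SIZING-21220.md` / `SIGMA-SCALING-21220.md` (item evidence on stmt-21220).  File `--supports stmt-NavierStokesRegularity-21220`.

THE OBJECT.  Fix the datum of record (`γ = 4`, `α = 21/5`, waist point `P = (√Γ/5, 0, 0)`, tilted direction
`e = (0, 1/√2, 1/√2)`; partner = image under the rotation `R_π : y ↦ 2⟪y, e₃⟫e₃ − y`).  For `Γ` large, a ball constant
`Rb` and an inverse local-induction coefficient `η` with `η Γ log Γ ≤ 7` (the nominal value is `8π/(γ log Γ)·Γ⁻¹`, i.e.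
`η Γ log Γ = 2π`), let `χ` be a smooth cut-off equal to `1` for `|t| ≤ (11/10) Rb√(Γ log Γ)` and `0` for
`|t| ≥ (6/5) Rb√(Γ log Γ)`, and let `x` be THE solution of the cut-off local-induction equation
`x″ = η χ(t) · x′ × (V(x) + U(t))`, `x(0) = P`, `x′(0) = e` (`V y = ½ y − (21/5) e₃ × y` the frame drift, `U` the
partner forcing FROZEN at its rung-0 values along the parameter — `…RungModelArcTools`), which exists globally and is unique
(`…RungCutoffShooting`).

`modelArc_rung` CERTIFIES, for every `0 < Rb ≤ 1/200`, every `Γ ≥ exp(Rb⁻²)` and every `0 < η ≤ 7/(Γ log Γ)`: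
`x` is `C²` with unit speed; its tangent stays within `1/500` of `e` on all of `ℝ` (Γ-UNIFORM bending `O(Rb²)`); curvature
`‖x″‖√Γ ≤ 1` (clause 2 with `K = 1`); `x″ = 0` for `|t| ≥ (6/5)Rb√(Γ log Γ)` (straight arms); radial growth
`‖x t‖ ≥ (499/500)|t|` (proper, clause 2) and linear escape with `cg = Rw = 1/2` (clause 4); chord–arc
`‖x τ − x σ‖ ≥ ½|τ − σ|` (clause 3); separation `‖x τ − R_π x σ‖ ≥ (39/100)√Γ` from the partner (clause 3, `ρ = 39/100`);
MODEL TANGENCY on the ball `‖x‖ ≤ Rb√(Γ log Γ)`: `V(x) + U + η⁻¹ x′ × x″ = w x′` with the slip `w = ⟪x′, V(x) + U⟫`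
(the model form of clause 8); and the slip has EXACTLY ONE zero `c₀` on `ℝ`, located in `(−(9/20)√Γ, −(7/20)√Γ)`, with
waist `‖x c₀‖ ≤ √Γ/2` (clause 9, `Rw = 1/2`), tilt `|⟪x′ c₀, e₃⟫| ≤ 1 − 1/5` (clause 10, `θ₀ = 1/5`, compatible with
`1/5 ≤ |α|, |γ| ≤ 5`), and SUPERCRITICAL slope `3/2 + 7/20 ≤ w′ c₀ ≤ 13/4` (clause 11, `δ = 7/20`, `Λ = 13/4`).

WHAT THIS IS / IS NOT.  This is R1 of the rung ladder: the EXISTENCE side, at MODEL level — (m1) the self-induction of the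
filament is replaced by local induction with coefficient `η⁻¹` (any `η ≤ 7/(Γ log Γ)`), switched off smoothly outside
`(6/5)×` the tangency ball; (m2) the partner's field is frozen at its rung-0 values along the parameter.  It is NOT an
instance of `SelectionBoxRJ`: clause 8 there is tangency of the PAIR's regularised Biot–Savart field, and clauses 12–13,
the `p`-family and the sign law are not addressed.  What it adds to rung 0 (`straightSkew_rung`, the straight `Γ → ∞`
limit, which is NOT tangent) is an honest `C²` object that IS (model-)tangent on the ball and still carries every
skeleton-level clause with explicit, `Γ`-uniform constants; the zero analysis (`…RungModelArcZero`) is stated for an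
abstract forcing error so that the true partner field (R2) and the self-induction remainder (R3) can be fed in later.
Constants are honest but unoptimised: perturbing about the STRAIGHT pair forces `Rb ≤ 1/200` and `log Γ ≥ Rb⁻²`; the
numerics' window `Rb ≈ 0.37` needs the binormal-arc base curve of `SIGMA-SCALING-21220.md` §2 (not attempted).  Nothing here
is a claim about Navier–Stokes regularity or blow-up.
-/

set_option linter.dupNamespace false -- `Theorems.…Theorems`-style path/namespace repetition is the tree convention

noncomputable section

namespace Summit.NavierStokesRegularity.NavierStokesRegularity.Theorems

open Set Function Filter Real Metric
open Literature.Analysis.FluidPDE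
open scoped InnerProductSpace Topology

namespace SelectionBoxRJRung

/-- **The arc (existence half of the model rung).**  For the constants of `rung_constants` there are a smooth cut-off `χ`
(`= 1` on `|t| ≤ (11/10)Rb√(Γ log Γ)`, `= 0` on `|t| ≥ (6/5)Rb√(Γ log Γ)`, values in `[0,1]`) and a global `C²` unit-speed
solution `x` of `x″ = (η χ) • x′ × (V(x) + U)` with `x 0 = P`, `x′ 0 = e`, whose tangent stays within `1/500` of `e` on
`ℝ`, with curvature `‖x″‖√Γ ≤ 1`, and straight (`x″ = 0`) for `|t| ≥ (6/5)Rb√(Γ log Γ)`. [folklore] -/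
theorem modelArc_exists {Γ Rb η : ℝ} (hRb0 : 0 < Rb) (hRb : Rb ≤ 1 / 200) (hΓ : Real.exp (1 / Rb ^ 2) ≤ Γ)
    (hη0 : 0 < η) (hη : η * (Γ * Real.log Γ) ≤ 7)
    (U : ℝ → EuclideanSpace ℝ (Fin 3))
    (hU : ∀ t, U t = (2 * Γ / Real.pi / (4 * Γ / 25 + 1 + t ^ 2)) •
      ((2 * Real.sqrt Γ / 5) • (WithLp.toLp 2 ![0, (Real.sqrt 2)⁻¹, (Real.sqrt 2)⁻¹] : EuclideanSpace ℝ (Fin 3)) -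
        t • WithLp.toLp 2 ![(1:ℝ), 0, 0])) :
    ∃ (χ : ℝ → ℝ) (x : ℝ → EuclideanSpace ℝ (Fin 3)),
      ((∀ n : ℕ∞, ContDiff ℝ n χ) ∧ (∀ t, |t| ≤ 11 / 10 * (Rb * Real.sqrt (Γ * Real.log Γ)) → χ t = 1) ∧
        (∀ t, 6 / 5 * (Rb * Real.sqrt (Γ * Real.log Γ)) ≤ |t| → χ t = 0) ∧ (∀ t, 0 ≤ χ t ∧ χ t ≤ 1)) ∧
      (ContDiff ℝ 2 x ∧ x 0 = WithLp.toLp 2 ![Real.sqrt Γ / 5, 0, 0] ∧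
        deriv x 0 = WithLp.toLp 2 ![0, (Real.sqrt 2)⁻¹, (Real.sqrt 2)⁻¹] ∧ (∀ t, ‖deriv x t‖ = 1) ∧
        (∀ t, iteratedDeriv 2 x t = (η * χ t) • cross (deriv x t)
          ((1 / 2 : ℝ) • x t - (21 / 5 : ℝ) • cross (EuclideanSpace.single 2 1) (x t) + U t))) ∧
      ((∀ t, ‖deriv x t - WithLp.toLp 2 ![0, (Real.sqrt 2)⁻¹, (Real.sqrt 2)⁻¹]‖ ≤ 1 / 500) ∧
        (∀ t, ‖iteratedDeriv 2 x t‖ * Real.sqrt Γ ≤ 1) ∧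
        (∀ t, 6 / 5 * (Rb * Real.sqrt (Γ * Real.log Γ)) ≤ |t| → iteratedDeriv 2 x t = 0)) := by
  obtain ⟨hΓ4, hS0, hθ, hcurvG⟩ := rung_constants hRb0 hRb hΓ hη0 hη
  have hΓ0 : 0 < Γ := by linarith [show (0:ℝ) < 10 ^ 4 by norm_num]
  have hG : 0 < Real.sqrt Γ := Real.sqrt_pos.2 hΓ0
  have hS₂0 : 0 < 6 / 5 * (Rb * Real.sqrt (Γ * Real.log Γ)) := by positivity
  have hM₂0 : 0 ≤ η * ((47 / 10) * (Real.sqrt Γ / 5 + 6 / 5 * (Rb * Real.sqrt (Γ * Real.log Γ))) +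
      8 / 5 * Real.sqrt Γ) := by positivity
  /- the cut-off and the arc -/
  obtain ⟨χ, hχs, hχ1, hχ0, hχnn, hχle⟩ := exists_smooth_cutoff
    (S₁ := 11 / 10 * (Rb * Real.sqrt (Γ * Real.log Γ))) (S₂ := 6 / 5 * (Rb * Real.sqrt (Γ * Real.log Γ))) (by linarith)
  have hcF : ContDiff ℝ 1 (fun q : ℝ × EuclideanSpace ℝ (Fin 3) => (η * χ q.1) •
      ((1 / 2 : ℝ) • q.2 - (21 / 5 : ℝ) • cross (EuclideanSpace.single 2 1) q.2 + U q.1)) := by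
    have h1 : ContDiff ℝ 1 (fun q : ℝ × EuclideanSpace ℝ (Fin 3) => χ q.1) := (hχs 1).comp contDiff_fst
    have h2 : ContDiff ℝ 1 (fun q : ℝ × EuclideanSpace ℝ (Fin 3) => U q.1) :=
      (U_contDiff hΓ0.le U hU 1).comp contDiff_fst
    have h3 : ContDiff ℝ 1 (fun q : ℝ × EuclideanSpace ℝ (Fin 3) =>
        cross (EuclideanSpace.single (2 : Fin 3) (1 : ℝ)) q.2) := by
      have : (fun q : ℝ × EuclideanSpace ℝ (Fin 3) => cross (EuclideanSpace.single (2 : Fin 3) (1 : ℝ)) q.2) =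
          fun q => crossCLM (EuclideanSpace.single (2 : Fin 3) (1 : ℝ)) q.2 := by
        funext q; rw [crossCLM_apply]
      rw [this]
      exact (crossCLM (EuclideanSpace.single (2 : Fin 3) (1 : ℝ))).contDiff.comp contDiff_snd
    exact (contDiff_const.mul h1).smul (((contDiff_snd.const_smul (1 / 2 : ℝ)).sub (h3.const_smul (21 / 5 : ℝ))).add h2)
  obtain ⟨x, hx, hx0, hx0', hunit, hode⟩ := cutoffLia_exists (fun t => η * χ t)
    (fun t y => (1 / 2 : ℝ) • y - (21 / 5 : ℝ) • cross (EuclideanSpace.single 2 1) y + U t) hcF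
    (WithLp.toLp 2 ![Real.sqrt Γ / 5, 0, 0]) (e := WithLp.toLp 2 ![0, (Real.sqrt 2)⁻¹, (Real.sqrt 2)⁻¹]) norm_tangent₁
  have hxd : Differentiable ℝ x := hx.differentiable (by norm_num)
  have hTd : Differentiable ℝ (deriv x) := hx.differentiable_deriv_two
  have h2 : iteratedDeriv 2 x = deriv (deriv x) := by rw [iteratedDeriv_succ, iteratedDeriv_one]
  /- curvature bound and straight arms -/
  have harm : ∀ t, 6 / 5 * (Rb * Real.sqrt (Γ * Real.log Γ)) ≤ |t| → iteratedDeriv 2 x t = 0 := by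
    intro t ht; rw [hode t, hχ0 t ht, mul_zero, zero_smul]
  have hpos : ∀ s, ‖x s‖ ≤ Real.sqrt Γ / 5 + |s| := by
    intro s
    have h := liaModel_position_bound hxd hunit s
    rwa [hx0, norm_waist Γ hΓ0.le] at h
  have hcurv : ∀ s, ‖iteratedDeriv 2 x s‖ ≤ η * ((47 / 10) * (Real.sqrt Γ / 5 +
      6 / 5 * (Rb * Real.sqrt (Γ * Real.log Γ))) + 8 / 5 * Real.sqrt Γ) := by
    intro s
    rcases le_or_gt (6 / 5 * (Rb * Real.sqrt (Γ * Real.log Γ))) |s| with hs | hs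
    · rw [harm s hs, norm_zero]; exact hM₂0
    · have h := liaModel_curvature_bound (η * χ s) (21 / 5) (8 / 5 * Real.sqrt Γ) (deriv x s) (x s) (U s)
        (iteratedDeriv 2 x s) (hunit s) (norm_U_le hΓ0 U hU s) (hode s)
      have hηχ : |η * χ s| ≤ η := by
        rw [abs_mul, abs_of_pos hη0, abs_of_nonneg (hχnn s)]
        nlinarith [hχle s]
      have hα : (1 / 2 + |(21 / 5 : ℝ)|) = 47 / 10 := by norm_num
      rw [hα] at h
      calc ‖iteratedDeriv 2 x s‖ ≤ |η * χ s| * (47 / 10 * ‖x s‖ + 8 / 5 * Real.sqrt Γ) := h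
        _ ≤ η * (47 / 10 * ‖x s‖ + 8 / 5 * Real.sqrt Γ) := mul_le_mul_of_nonneg_right hηχ (by positivity)
        _ ≤ _ := by
            refine mul_le_mul_of_nonneg_left ?_ hη0.le
            nlinarith [hpos s, hs.le]
  /- near-straightness on all of ℝ -/
  have hin : ∀ t, |t| ≤ 6 / 5 * (Rb * Real.sqrt (Γ * Real.log Γ)) →
      ‖deriv x t - WithLp.toLp 2 ![0, (Real.sqrt 2)⁻¹, (Real.sqrt 2)⁻¹]‖ ≤ 1 / 500 := by
    intro t ht
    have h := Convex.norm_image_sub_le_of_norm_deriv_le (f := deriv x) (fun v _ => hTd v)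
      (fun v _ => by rw [← congrFun h2 v]; exact hcurv v) convex_univ (mem_univ 0) (mem_univ t)
    rw [hx0', sub_zero, Real.norm_eq_abs] at h
    exact h.trans ((mul_le_mul_of_nonneg_left ht hM₂0).trans hθ)
  have hout : ∀ t, 6 / 5 * (Rb * Real.sqrt (Γ * Real.log Γ)) ≤ |t| →
      ∃ t₀, |t₀| ≤ 6 / 5 * (Rb * Real.sqrt (Γ * Real.log Γ)) ∧ deriv x t = deriv x t₀ := by
    intro t ht
    rcases le_or_gt 0 t with ht0 | ht0
    · rw [abs_of_nonneg ht0] at ht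
      refine ⟨6 / 5 * (Rb * Real.sqrt (Γ * Real.log Γ)), by rw [abs_of_pos hS₂0], ?_⟩
      have h := Convex.norm_image_sub_le_of_norm_deriv_le (f := deriv x)
        (s := Ici (6 / 5 * (Rb * Real.sqrt (Γ * Real.log Γ)))) (C := 0)
        (fun v _ => hTd v) (fun v hv => by
          rw [← congrFun h2 v, harm v (by rw [abs_of_nonneg (hS₂0.le.trans hv)]; exact hv), norm_zero])
        (convex_Ici _) (mem_Ici.2 le_rfl) (mem_Ici.2 ht)
      rw [zero_mul, norm_le_zero_iff, sub_eq_zero] at h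
      exact h
    · rw [abs_of_neg ht0] at ht
      refine ⟨-(6 / 5 * (Rb * Real.sqrt (Γ * Real.log Γ))), by rw [abs_neg, abs_of_pos hS₂0], ?_⟩
      have h := Convex.norm_image_sub_le_of_norm_deriv_le (f := deriv x)
        (s := Iic (-(6 / 5 * (Rb * Real.sqrt (Γ * Real.log Γ))))) (C := 0)
        (fun v _ => hTd v) (fun v hv => by
          have hv' : 6 / 5 * (Rb * Real.sqrt (Γ * Real.log Γ)) ≤ |v| := by
            have hvle := mem_Iic.1 hv
            rw [abs_of_nonpos (by linarith)]; linarith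
          rw [← congrFun h2 v, harm v hv', norm_zero])
        (convex_Iic _) (mem_Iic.2 le_rfl)
        (mem_Iic.2 (by linarith [ht] : t ≤ -(6 / 5 * (Rb * Real.sqrt (Γ * Real.log Γ)))))
      rw [zero_mul, norm_le_zero_iff, sub_eq_zero] at h
      exact h
  have hnear : ∀ t, ‖deriv x t - WithLp.toLp 2 ![0, (Real.sqrt 2)⁻¹, (Real.sqrt 2)⁻¹]‖ ≤ 1 / 500 := by
    intro t
    rcases le_or_gt |t| (6 / 5 * (Rb * Real.sqrt (Γ * Real.log Γ))) with ht | ht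
    · exact hin t ht
    · obtain ⟨t₀, ht₀, heq⟩ := hout t ht.le
      rw [heq]; exact hin t₀ ht₀
  refine ⟨χ, x, ⟨hχs, hχ1, hχ0, fun t => ⟨hχnn t, hχle t⟩⟩, ⟨hx, hx0, hx0', hunit, hode⟩, hnear, fun t => ?_, harm⟩
  calc ‖iteratedDeriv 2 x t‖ * Real.sqrt Γ ≤ η * ((47 / 10) * (Real.sqrt Γ / 5 +
        6 / 5 * (Rb * Real.sqrt (Γ * Real.log Γ))) + 8 / 5 * Real.sqrt Γ) * Real.sqrt Γ :=
        mul_le_mul_of_nonneg_right (hcurv t) hG.le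
    _ ≤ 1 := hcurvG

set_option maxHeartbeats 400000 in
/-- **RUNG 1 (MODEL RUNG) of `SelectionBoxRJ`: the cut-off local-induction arc through the rung-0 waist datum.**  See the
module docstring for the list of certified clauses and for what is model about it (frozen partner forcing, local
induction in place of the self-induction, switched off outside `(6/5)×` the tangency ball).  Constants: `Rb ≤ 1/200`,
`Γ ≥ exp(Rb⁻²)`, `0 < η ≤ 7/(Γ log Γ)`; `K = 1`, `cg = Rw = 1/2`, `ρ = 39/100`, `θ₀ = 1/5`, `δ = 7/20`, `Λ = 13/4`.
NOT an instance of `SelectionBoxRJ`; nothing about NS regularity or blow-up. [folklore] -/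
theorem modelArc_rung {Γ Rb η : ℝ} (hRb0 : 0 < Rb) (hRb : Rb ≤ 1 / 200) (hΓ : Real.exp (1 / Rb ^ 2) ≤ Γ)
    (hη0 : 0 < η) (hη : η * (Γ * Real.log Γ) ≤ 7)
    (U : ℝ → EuclideanSpace ℝ (Fin 3))
    (hU : ∀ t, U t = (2 * Γ / Real.pi / (4 * Γ / 25 + 1 + t ^ 2)) •
      ((2 * Real.sqrt Γ / 5) • (WithLp.toLp 2 ![0, (Real.sqrt 2)⁻¹, (Real.sqrt 2)⁻¹] : EuclideanSpace ℝ (Fin 3)) -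
        t • WithLp.toLp 2 ![(1:ℝ), 0, 0])) :
    ∃ (χ : ℝ → ℝ) (x : ℝ → EuclideanSpace ℝ (Fin 3)) (w : ℝ → ℝ) (c₀ : ℝ),
      -- the cut-off
      ((∀ n : ℕ∞, ContDiff ℝ n χ) ∧ (∀ t, |t| ≤ 11 / 10 * (Rb * Real.sqrt (Γ * Real.log Γ)) → χ t = 1) ∧
        (∀ t, 6 / 5 * (Rb * Real.sqrt (Γ * Real.log Γ)) ≤ |t| → χ t = 0) ∧ (∀ t, 0 ≤ χ t ∧ χ t ≤ 1)) ∧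
      -- the arc: Cauchy data, unit speed, the cut-off local-induction equation
      (ContDiff ℝ 2 x ∧ x 0 = WithLp.toLp 2 ![Real.sqrt Γ / 5, 0, 0] ∧
        deriv x 0 = WithLp.toLp 2 ![0, (Real.sqrt 2)⁻¹, (Real.sqrt 2)⁻¹] ∧ (∀ t, ‖deriv x t‖ = 1) ∧
        (∀ t, iteratedDeriv 2 x t = (η * χ t) • cross (deriv x t)
          ((1 / 2 : ℝ) • x t - (21 / 5 : ℝ) • cross (EuclideanSpace.single 2 1) (x t) + U t))) ∧
      -- near-straightness (Γ-uniform bending), curvature (clause 2, `K = 1`), straight arms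
      ((∀ t, ‖deriv x t - WithLp.toLp 2 ![0, (Real.sqrt 2)⁻¹, (Real.sqrt 2)⁻¹]‖ ≤ 1 / 500) ∧
        (∀ t, ‖iteratedDeriv 2 x t‖ * Real.sqrt Γ ≤ 1) ∧
        (∀ t, 6 / 5 * (Rb * Real.sqrt (Γ * Real.log Γ)) ≤ |t| → iteratedDeriv 2 x t = 0)) ∧
      -- radial growth, properness, chord–arc (clause 3, `cg = 1/2`), separation from the partner (`ρ = 39/100`)
      ((∀ t, 499 / 500 * |t| ≤ ‖x t‖) ∧ Tendsto (fun t => ‖x t‖) (cocompact ℝ) atTop ∧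
        (∀ τ σ, 1 / 2 * |τ - σ| ≤ ‖x τ - x σ‖) ∧
        (∀ τ σ, 39 / 100 * Real.sqrt Γ ≤
          ‖x τ - ((2 * ⟪x σ, EuclideanSpace.single 2 1⟫_ℝ) • (EuclideanSpace.single (2 : Fin 3) (1 : ℝ)) - x σ)‖)) ∧
      -- the model slip and MODEL TANGENCY on the ball (clause 8, model form)
      ((∀ t, w t = ⟪deriv x t,
          ((1 / 2 : ℝ) • x t - (21 / 5 : ℝ) • cross (EuclideanSpace.single 2 1) (x t)) + U t⟫_ℝ) ∧
        (∀ t, ‖x t‖ ≤ Rb * Real.sqrt (Γ * Real.log Γ) →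
          ((1 / 2 : ℝ) • x t - (21 / 5 : ℝ) • cross (EuclideanSpace.single 2 1) (x t)) + U t +
              η⁻¹ • cross (deriv x t) (iteratedDeriv 2 x t) = w t • deriv x t)) ∧
      -- the stagnation zero: unique on ℝ, location, waist (clause 9), tilt (clause 10), slope (clause 11), escape (4)
      (Differentiable ℝ w ∧ w c₀ = 0 ∧ (∀ τ, w τ = 0 → τ = c₀) ∧
        -(9 / 20) * Real.sqrt Γ < c₀ ∧ c₀ < -(7 / 20) * Real.sqrt Γ ∧ ‖x c₀‖ ≤ 1 / 2 * Real.sqrt Γ ∧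
        |⟪deriv x c₀, EuclideanSpace.single 2 1⟫_ℝ| ≤ 1 - 1 / 5 ∧
        3 / 2 + 7 / 20 ≤ deriv w c₀ ∧ deriv w c₀ ≤ 13 / 4 ∧
        (∀ t, 1 / 2 * |t - c₀| ≤ 1 / 2 * Real.sqrt Γ + ‖x t‖)) ∧
      -- parameter bounds (clause 11's `θ₀ = 1/5`)
      ((1 / 5 : ℝ) ≤ |(21 / 5 : ℝ)| ∧ |(21 / 5 : ℝ)| ≤ (1 / 5)⁻¹ ∧ (1 / 5 : ℝ) ≤ |(4 : ℝ)| ∧ |(4 : ℝ)| ≤ (1 / 5)⁻¹) := by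
  obtain ⟨hΓ4, hS0, -, -⟩ := rung_constants hRb0 hRb hΓ hη0 hη
  have hΓ0 : 0 < Γ := by linarith [show (0:ℝ) < 10 ^ 4 by norm_num]
  have hG : 0 < Real.sqrt Γ := Real.sqrt_pos.2 hΓ0
  have hG2 : Real.sqrt Γ ^ 2 = Γ := Real.sq_sqrt hΓ0.le
  obtain ⟨χ, x, ⟨hχs, hχ1, hχ0, hχ01⟩, ⟨hx, hx0, hx0', hunit, hode⟩, hnear, hcurv1, harm⟩ :=
    modelArc_exists hRb0 hRb hΓ hη0 hη U hU
  have hxd : Differentiable ℝ x := hx.differentiable (by norm_num)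
  /- radial growth and properness -/
  have hrad : ∀ t, 499 / 500 * |t| ≤ ‖x t‖ := fun t => by
    have := arc_norm_ge (θ := 1 / 500) hΓ0.le hxd hx0 hnear t; norm_num at this ⊢; linarith
  have hproper : Tendsto (fun t => ‖x t‖) (cocompact ℝ) atTop := by
    have h1 : Tendsto (fun t : ℝ => 499 / 500 * ‖t‖) (cocompact ℝ) atTop :=
      tendsto_norm_cocompact_atTop.const_mul_atTop (by norm_num)
    refine tendsto_atTop_mono (fun t => ?_) h1
    rw [Real.norm_eq_abs]; exact hrad t
  /- chord–arc -/
  have hchord : ∀ τ σ, 1 / 2 * |τ - σ| ≤ ‖x τ - x σ‖ := by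
    intro τ σ
    have he1 : ‖(WithLp.toLp 2 ![0, (Real.sqrt 2)⁻¹, (Real.sqrt 2)⁻¹] : EuclideanSpace ℝ (Fin 3))‖ = 1 := norm_tangent₁
    have hg : ∀ t, HasDerivAt (fun s => ⟪x s, (WithLp.toLp 2 ![0, (Real.sqrt 2)⁻¹, (Real.sqrt 2)⁻¹] :
        EuclideanSpace ℝ (Fin 3))⟫_ℝ) ⟪deriv x t, (WithLp.toLp 2 ![0, (Real.sqrt 2)⁻¹, (Real.sqrt 2)⁻¹] :
        EuclideanSpace ℝ (Fin 3))⟫_ℝ t := fun t => by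
      have := ((hxd t).hasDerivAt).inner ℝ (hasDerivAt_const t
        (WithLp.toLp 2 ![0, (Real.sqrt 2)⁻¹, (Real.sqrt 2)⁻¹] : EuclideanSpace ℝ (Fin 3)))
      simpa using this
    have hg' : ∀ t, 99 / 100 ≤ deriv (fun s => ⟪x s, (WithLp.toLp 2 ![0, (Real.sqrt 2)⁻¹, (Real.sqrt 2)⁻¹] :
        EuclideanSpace ℝ (Fin 3))⟫_ℝ) t := fun t => by
      rw [(hg t).deriv]
      have hsq : ‖deriv x t - WithLp.toLp 2 ![0, (Real.sqrt 2)⁻¹, (Real.sqrt 2)⁻¹]‖ ^ 2 =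
          2 - 2 * ⟪deriv x t, (WithLp.toLp 2 ![0, (Real.sqrt 2)⁻¹, (Real.sqrt 2)⁻¹] : EuclideanSpace ℝ (Fin 3))⟫_ℝ := by
        rw [norm_sub_sq_real, hunit t, he1]; ring
      nlinarith [norm_nonneg (deriv x t - WithLp.toLp 2 ![0, (Real.sqrt 2)⁻¹, (Real.sqrt 2)⁻¹]), hsq, hnear t]
    have hmv := Convex.mul_sub_le_image_sub_of_le_deriv convex_univ
      (fun t _ => (hg t).continuousAt.continuousWithinAt)
      (fun t _ => (hg t).differentiableAt.differentiableWithinAt) (fun t _ => hg' t)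
    have hcs : |⟪x τ, (WithLp.toLp 2 ![0, (Real.sqrt 2)⁻¹, (Real.sqrt 2)⁻¹] : EuclideanSpace ℝ (Fin 3))⟫_ℝ -
        ⟪x σ, (WithLp.toLp 2 ![0, (Real.sqrt 2)⁻¹, (Real.sqrt 2)⁻¹] : EuclideanSpace ℝ (Fin 3))⟫_ℝ| ≤ ‖x τ - x σ‖ := by
      rw [← inner_sub_left]
      calc _ ≤ ‖x τ - x σ‖ * ‖(WithLp.toLp 2 ![0, (Real.sqrt 2)⁻¹, (Real.sqrt 2)⁻¹] : EuclideanSpace ℝ (Fin 3))‖ :=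
            abs_real_inner_le_norm _ _
        _ = ‖x τ - x σ‖ := by rw [he1, mul_one]
    rcases le_or_gt σ τ with hle | hle
    · have h := hmv σ (mem_univ _) τ (mem_univ _) hle
      rw [abs_of_nonneg (by linarith : 0 ≤ τ - σ)]
      have := le_abs_self (⟪x τ, (WithLp.toLp 2 ![0, (Real.sqrt 2)⁻¹, (Real.sqrt 2)⁻¹] : EuclideanSpace ℝ (Fin 3))⟫_ℝ -
        ⟪x σ, (WithLp.toLp 2 ![0, (Real.sqrt 2)⁻¹, (Real.sqrt 2)⁻¹] : EuclideanSpace ℝ (Fin 3))⟫_ℝ)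
      linarith
    · have h := hmv τ (mem_univ _) σ (mem_univ _) hle.le
      rw [abs_of_neg (by linarith : τ - σ < 0)]
      have := neg_abs_le (⟪x τ, (WithLp.toLp 2 ![0, (Real.sqrt 2)⁻¹, (Real.sqrt 2)⁻¹] : EuclideanSpace ℝ (Fin 3))⟫_ℝ -
        ⟪x σ, (WithLp.toLp 2 ![0, (Real.sqrt 2)⁻¹, (Real.sqrt 2)⁻¹] : EuclideanSpace ℝ (Fin 3))⟫_ℝ)
      linarith
  /- separation from the partner `R_π x` -/
  have hsep : ∀ τ σ, 39 / 100 * Real.sqrt Γ ≤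
      ‖x τ - ((2 * ⟪x σ, EuclideanSpace.single 2 1⟫_ℝ) • (EuclideanSpace.single (2 : Fin 3) (1 : ℝ)) - x σ)‖ := by
    intro τ σ
    have hRlin : ∀ a b : EuclideanSpace ℝ (Fin 3),
        ((2 * ⟪a, EuclideanSpace.single 2 1⟫_ℝ) • (EuclideanSpace.single (2 : Fin 3) (1 : ℝ)) - a) -
          ((2 * ⟪b, EuclideanSpace.single 2 1⟫_ℝ) • (EuclideanSpace.single (2 : Fin 3) (1 : ℝ)) - b) =
          (2 * ⟪a - b, EuclideanSpace.single 2 1⟫_ℝ) • (EuclideanSpace.single (2 : Fin 3) (1 : ℝ)) - (a - b) := by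
      intro a b; rw [inner_sub_left, mul_sub, sub_smul]; abel
    have hdτ := arc_displacement_le (θ := 1 / 500) hxd hx0 hnear τ
    have hdσ := arc_displacement_le (θ := 1 / 500) hxd hx0 hnear σ
    have hN2 := norm_sq_line_sub_rot Γ τ σ hΓ0.le
    -- abbreviations (plain `obtain`, so the goal is untouched)
    obtain ⟨P, hP⟩ : ∃ P : EuclideanSpace ℝ (Fin 3), P = WithLp.toLp 2 ![Real.sqrt Γ / 5, 0, 0] := ⟨_, rfl⟩
    obtain ⟨e, he⟩ : ∃ e : EuclideanSpace ℝ (Fin 3), e = WithLp.toLp 2 ![0, (Real.sqrt 2)⁻¹, (Real.sqrt 2)⁻¹] := ⟨_, rfl⟩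
    obtain ⟨e₃, he₃⟩ : ∃ e₃ : EuclideanSpace ℝ (Fin 3), e₃ = EuclideanSpace.single (2 : Fin 3) (1 : ℝ) := ⟨_, rfl⟩
    rw [← hP, ← he] at hdτ hdσ hN2
    rw [← he₃] at hN2 hRlin ⊢
    have hN0 := norm_nonneg ((P + τ • e) - ((2 * ⟪P + σ • e, e₃⟫_ℝ) • e₃ - (P + σ • e)))
    have hNG : 2 * Real.sqrt Γ / 5 ≤ ‖(P + τ • e) - ((2 * ⟪P + σ • e, e₃⟫_ℝ) • e₃ - (P + σ • e))‖ := by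
      nlinarith [hN2, hG2, hG, sq_nonneg τ, sq_nonneg σ, hN0, mul_nonneg hN0 hG.le]
    have hNτ : |τ| ≤ ‖(P + τ • e) - ((2 * ⟪P + σ • e, e₃⟫_ℝ) • e₃ - (P + σ • e))‖ := by
      nlinarith [hN2, sq_abs τ, hΓ0, sq_nonneg σ, abs_nonneg τ, hN0, mul_nonneg hN0 (abs_nonneg τ)]
    have hNσ : |σ| ≤ ‖(P + τ • e) - ((2 * ⟪P + σ • e, e₃⟫_ℝ) • e₃ - (P + σ • e))‖ := by
      nlinarith [hN2, sq_abs σ, hΓ0, sq_nonneg τ, abs_nonneg σ, hN0, mul_nonneg hN0 (abs_nonneg σ)]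
    have hdec : x τ - ((2 * ⟪x σ, e₃⟫_ℝ) • e₃ - x σ) =
        ((P + τ • e) - ((2 * ⟪P + σ • e, e₃⟫_ℝ) • e₃ - (P + σ • e))) + (x τ - (P + τ • e)) -
          ((2 * ⟪x σ - (P + σ • e), e₃⟫_ℝ) • e₃ - (x σ - (P + σ • e))) := by
      rw [← hRlin]; abel
    have hRn : ‖(2 * ⟪x σ - (P + σ • e), e₃⟫_ℝ) • e₃ - (x σ - (P + σ • e))‖ = ‖x σ - (P + σ • e)‖ := by
      rw [he₃]; exact norm_rotPi _
    have key : ∀ A B C : EuclideanSpace ℝ (Fin 3), ‖A‖ ≤ ‖A + B - C‖ + ‖B‖ + ‖C‖ := by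
      intro A B C
      have e1 : A = (A + B - C) + (C - B) := by abel
      calc ‖A‖ = ‖(A + B - C) + (C - B)‖ := by rw [← e1]
        _ ≤ ‖A + B - C‖ + ‖C - B‖ := norm_add_le _ _
        _ ≤ ‖A + B - C‖ + (‖C‖ + ‖B‖) := by gcongr; exact norm_sub_le _ _
        _ = ‖A + B - C‖ + ‖B‖ + ‖C‖ := by ring
    have hk := key ((P + τ • e) - ((2 * ⟪P + σ • e, e₃⟫_ℝ) • e₃ - (P + σ • e))) (x τ - (P + τ • e))
      ((2 * ⟪x σ - (P + σ • e), e₃⟫_ℝ) • e₃ - (x σ - (P + σ • e)))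
    rw [← hdec, hRn] at hk
    nlinarith [hk, hdτ, hdσ, hNτ, hNσ, hNG, hG]
  /- MODEL tangency on the ball -/
  have htan : ∀ t, ‖x t‖ ≤ Rb * Real.sqrt (Γ * Real.log Γ) →
      ((1 / 2 : ℝ) • x t - (21 / 5 : ℝ) • cross (EuclideanSpace.single 2 1) (x t)) + U t +
          η⁻¹ • cross (deriv x t) (iteratedDeriv 2 x t) =
        ⟪deriv x t, ((1 / 2 : ℝ) • x t - (21 / 5 : ℝ) • cross (EuclideanSpace.single 2 1) (x t)) + U t⟫_ℝ •
          deriv x t := by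
    intro t ht
    have ht' : |t| ≤ 11 / 10 * (Rb * Real.sqrt (Γ * Real.log Γ)) := by
      have := hrad t
      nlinarith [this, ht, hS0]
    have hχt : χ t = 1 := hχ1 t ht'
    have hode' : iteratedDeriv 2 x t = η • cross (deriv x t)
        ((1 / 2 : ℝ) • x t - (21 / 5 : ℝ) • cross (EuclideanSpace.single 2 1) (x t) + U t) := by
      rw [hode t, hχt, mul_one]
    have h := liaModel_tangency η (21 / 5) hη0.ne' (deriv x t) (x t) (U t) (iteratedDeriv 2 x t) (hunit t) hode'
    calc ((1 / 2 : ℝ) • x t - (21 / 5 : ℝ) • cross (EuclideanSpace.single 2 1) (x t)) + U t +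
          η⁻¹ • cross (deriv x t) (iteratedDeriv 2 x t)
        = η⁻¹ • cross (deriv x t) (iteratedDeriv 2 x t) + U t +
            ((1 / 2 : ℝ) • x t - (21 / 5 : ℝ) • cross (EuclideanSpace.single 2 1) (x t)) := by abel
      _ = _ := h
  /- the zero package (forcing error zero) -/
  have hUd := U_differentiable hΓ0.le U hU
  obtain ⟨hwdiff, ⟨c₀, hc₀, huniq⟩, hall⟩ := slip_zero_package (θ := 1 / 500) (ε₀ := 0) (ε₁ := 0) hΓ4 (by norm_num)
    le_rfl (by norm_num) (by norm_num) U hU hx hunit hx0 hnear hode hUd (fun t => by simp) (fun t => by simp)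
    (fun t => ⟪deriv x t, ((1 / 2 : ℝ) • x t - (21 / 5 : ℝ) • cross (EuclideanSpace.single 2 1) (x t)) + U t⟫_ℝ)
    (fun t => rfl)
  obtain ⟨hc1, hc2, hwaist, htilt, hsl1, hsl2⟩ := hall c₀ hc₀
  have hesc : ∀ t, 1 / 2 * |t - c₀| ≤ 1 / 2 * Real.sqrt Γ + ‖x t‖ := by
    intro t
    have h1 := hrad t
    have h2 : |t - c₀| ≤ |t| + |c₀| := abs_sub _ _
    have hc0 : c₀ < 0 := by linarith only [hc2, hG]
    have h3 : |c₀| ≤ 9 / 20 * Real.sqrt Γ := by rw [abs_of_neg hc0]; linarith only [hc1]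
    linarith only [h1, h2, h3, hG, norm_nonneg (x t)]
  have hwaist' : ‖x c₀‖ ≤ 1 / 2 * Real.sqrt Γ := by linarith only [hwaist]
  have hsl1' : 3 / 2 + 7 / 20 ≤ deriv (fun t => ⟪deriv x t, ((1 / 2 : ℝ) • x t -
      (21 / 5 : ℝ) • cross (EuclideanSpace.single 2 1) (x t)) + U t⟫_ℝ) c₀ := by linarith only [hsl1]
  exact ⟨χ, x, fun t => ⟪deriv x t, ((1 / 2 : ℝ) • x t - (21 / 5 : ℝ) • cross (EuclideanSpace.single 2 1) (x t)) +
      U t⟫_ℝ, c₀, ⟨hχs, hχ1, hχ0, hχ01⟩, ⟨hx, hx0, hx0', hunit, hode⟩, ⟨hnear, hcurv1, harm⟩,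
    ⟨hrad, hproper, hchord, hsep⟩, ⟨fun t => rfl, htan⟩,
    ⟨hwdiff, hc₀, huniq, hc1, hc2, hwaist', htilt, hsl1', hsl2, hesc⟩, by norm_num⟩

end SelectionBoxRJRung

end Summit.NavierStokesRegularity.NavierStokesRegularity.Theorems
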